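import Literature.NumberTheory.Automorphic.ArchLocalSingularTorusClasses    -- (V8)-sing FILE 1 (B-p17 (g23)): (A) `card_filter_fibre_pos_eq_of_conj_circleDiagonal`, (B), (C‴)
import HarnessLib

/-!
# The two conjugacy classes through the split-singular torus point `diag(a,a,b)` of `U(2,1)`
# (road D2′ gap «(V8)-sing», docking `N = 3`; Rogawski 1990 §8.3 p. 122 (§8.2 Prop. 8.2.1 p. 118), §3.8)

Topic `NumberTheory/Automorphic`; namespace `Literature.NumberTheory.Automorphic.UnitaryGroup`.  THEOREMS ONLY (no `def`, no instance, no notation,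
no axiom, no `sorry`).  Cell `pub/hodgecm-mathlib`, ENGINE T1 (crux H413 = `stmt-HodgeConjecture-24833`); floor-1 preparation, count-neutral, under
books rows #88 (ST-∞) ∕ #111 (S-d); author B-p17 (g23) on LEAD WORD T7-5 (11) (F0P3a-plan (g8), 2026-09-01), FILE 2 of «(V8)-sing» (FILE 1 =
★∕rf `ArchLocalSingularTorusClasses`: the per-fibre sign distribution classifies torus points of a stable class).

SETTING (`N = 3`). `e : Fin 3 → ℝ` INDEFINITE (`∃ i j, 0 < e i ∧ e j < 0` — signature (2,1) or (1,2): `U(diag e)(ℂ) ≅ U(2,1)`; at a complex place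
`w` of a CM field this is `G_w = archLocal L 3 (diagonal α) w` with `e = re ∘ σ_w ∘ α`, cf. «(V8)-reg» §5), `e_j ≠ 0`; a torus point `diag z`,
`z : Fin 3 → Circle`, with EXACTLY TWO VALUES: a «singular slot» `k` with `z j = z k ↔ j = k` and `z` constant off `k` — i.e. `z` is `(a, a, b)`, `a ≠ b`,
in some order: the SPLIT-SINGULAR point `γ₀ = diag(a,a,b)` of Rogawski §8.2.  Its stable (= `GL₃(ℂ)`-) class contains the relabelled torus
points `diag (z ∘ ρ⁻¹)`, `ρ ∈ S₃` (★ `charpoly_circleDiagonal_comp_perm`).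

WHAT IS PROVED.
* `not_exists_conj_circleDiagonal_swap_neg_swap_pos` — «`b` over a NEGATIVE slot» and «`b` over a POSITIVE slot» are NOT conjugate in `U(diag e)(ℂ)`
  (FILE 1 (A) at the singleton fibre of `b`);
* `exists_conj_circleDiagonal_perm_of_pos_iff` — two relabelled points whose `b`-slots carry form entries of the SAME sign ARE conjugate in
  `U(diag e)(ℂ)` (FILE 1 (B); the `a`-fibre count follows from the `b`-fibre count by complementation);
* **`ncard_conjClasses_circleDiagonal_perm_eq_two`** — the six relabelled torus points of the stable class of `γ₀ = diag(a,a,b)` fall into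
  **EXACTLY TWO** conjugacy classes of `U(diag e)(ℂ)`, against THREE (`= choose 3 1`, «(V8)-reg») through a regular point — Rogawski's count of
  the classes «through» the singular point of the compact Cartan of `U(2,1)` [Rogawski1990, §8.3 p. 122 (§8.2 Prop. 8.2.1 p. 118)].
NOT HERE (sequel «(V8)-exh»): that every element of the stable class of `γ₀` is conjugate to a torus point, which turns the last statement into
`ncard {stable class of γ₀} ∕ conj = 2`.  HONEST LABEL: HC_CM is proved only modulo the printed citations until rung 0 closes; this file is
finite bookkeeping over FILE 1 and pays nothing by itself.

## References
* [Rogawski1990] J. D. Rogawski, *Automorphic Representations of Unitary Groups in Three Variables*, Ann. of Math. Stud. 123 (1990): §3.8 pp. 30–32 (Prop. 3.8.1)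
  (classes within a stable class), §8.3 p. 122 (§8.2 Prop. 8.2.1 p. 118) (the classes through regular and singular points of the compact Cartan of `U(2,1)`).
* [HornJohnson2013] R. A. Horn, C. R. Johnson, *Matrix Analysis*, 2nd ed. (2013), §4.5 Thm. 4.5.8 (Sylvester's law of inertia).
-/

set_option autoImplicit false

noncomputable section

open Matrix Equiv Finset
open Literature.LinearAlgebra.Matrix
open scoped MatrixGroups ComplexConjugate

namespace Literature.NumberTheory.Automorphic.UnitaryGroup

/-! ## §0 Fibre bookkeeping (private) -/

section Bookkeeping

variable {N : ℕ}

open scoped Classical in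
/-- Counting over a singleton fibre: if `z j = z k ↔ j = k` then the `z k`-fibre of the relabelled point `z ∘ ρ⁻¹` is `{ρ k}`. [folklore] -/
private theorem card_filter_fibre_singular {z : Fin N → Circle} {k : Fin N} (hk : ∀ j, z j = z k ↔ j = k) (ρ : Perm (Fin N))
    (p : Fin N → Prop) :
    (univ.filter fun i => z (ρ.symm i) = z k ∧ p i).card = if p (ρ k) then 1 else 0 := by
  have hset : (univ.filter fun i => z (ρ.symm i) = z k ∧ p i) = if p (ρ k) then {ρ k} else ∅ := by
    ext i
    simp only [Finset.mem_filter, Finset.mem_univ, true_and, hk, Equiv.symm_apply_eq]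
    split_ifs with hp
    · simp only [Finset.mem_singleton]
      exact ⟨fun h => h.1, fun h => ⟨h, h ▸ hp⟩⟩
    · simp only [Finset.notMem_empty, iff_false, not_and]
      intro hi; rw [hi]; exact hp
  rw [hset]
  split_ifs <;> simp

open scoped Classical in
/-- Counting over an empty fibre. [folklore] -/
private theorem card_filter_fibre_eq_zero_of_forall_ne {z : Fin N → Circle} {c : Circle} (hc : ∀ j, z j ≠ c) (ρ : Perm (Fin N))
    (p : Fin N → Prop) : (univ.filter fun i => z (ρ.symm i) = c ∧ p i).card = 0 := by
  rw [Finset.card_eq_zero, Finset.filter_eq_empty_iff]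
  intro i _ h
  exact hc _ h.1

open scoped Classical in
/-- Complementation: if two predicates with the same total count agree on every fibre of `f` but one, they agree on that fibre too. [folklore] -/
private theorem card_filter_fibre_eq_of_forall_ne {ι : Type*} (f : Fin N → ι) (p q : Fin N → Prop)
    (htot : (univ.filter p).card = (univ.filter q).card) (c₀ : ι)
    (h : ∀ c, c ≠ c₀ → (univ.filter fun i => f i = c ∧ p i).card = (univ.filter fun i => f i = c ∧ q i).card) :
    (univ.filter fun i => f i = c₀ ∧ p i).card = (univ.filter fun i => f i = c₀ ∧ q i).card := by
  -- total counts as sums over the fibres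
  have hsum : ∀ r : Fin N → Prop, (univ.filter r).card = ∑ c ∈ univ.image f, (univ.filter fun i => f i = c ∧ r i).card := by
    intro r
    rw [Finset.card_eq_sum_card_fiberwise (f := f) (t := univ.image f) fun i _ => Finset.mem_image_of_mem f (Finset.mem_univ i)]
    refine Finset.sum_congr rfl fun c _ => ?_
    congr 1
    ext i
    simp only [Finset.mem_filter, Finset.mem_univ, true_and]
    exact and_comm
  by_cases hc₀ : c₀ ∈ univ.image f
  · have hp := hsum p
    have hq := hsum q
    rw [← Finset.add_sum_erase _ _ hc₀] at hp hq
    have herase : ∑ c ∈ (univ.image f).erase c₀, (univ.filter fun i => f i = c ∧ p i).card =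
        ∑ c ∈ (univ.image f).erase c₀, (univ.filter fun i => f i = c ∧ q i).card :=
      Finset.sum_congr rfl fun c hc => h c (Finset.ne_of_mem_erase hc)
    omega
  · have hnone : ∀ i, f i ≠ c₀ := fun i hi => hc₀ (hi ▸ Finset.mem_image_of_mem f (Finset.mem_univ i))
    have hz : ∀ r : Fin N → Prop, (univ.filter fun i => f i = c₀ ∧ r i).card = 0 := fun r => by
      rw [Finset.card_eq_zero, Finset.filter_eq_empty_iff]; exact fun i _ hh => hnone i hh.1
    rw [hz, hz]

open scoped Classical in
/-- A relabelling does not change the number of positive form entries. [folklore] -/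
private theorem card_filter_pos_perm (e : Fin N → ℝ) (τ : Perm (Fin N)) :
    (univ.filter fun j => 0 < e (τ j)).card = (univ.filter fun j => 0 < e j).card := by
  rw [← Fintype.card_subtype, ← Fintype.card_subtype]
  exact Fintype.card_congr (Equiv.subtypeEquiv τ fun j => Iff.rfl)

/-- Conjugacy classes of a subgroup, read on the ambient group. [folklore] -/
private theorem conjClasses_mk_eq_mk_iff_exists_coe_conj' {G : Type*} [Group G] {H : Subgroup G} (x y : H) :
    ConjClasses.mk x = ConjClasses.mk y ↔ ∃ g : H, (g : G) * (x : G) * (g : G)⁻¹ = y := by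
  rw [ConjClasses.mk_eq_mk_iff_isConj, isConj_iff]
  constructor
  · rintro ⟨c, hc⟩
    exact ⟨c, by rw [← hc, Subgroup.coe_mul, Subgroup.coe_mul, Subgroup.coe_inv]⟩
  · rintro ⟨g, hg⟩
    exact ⟨g, Subtype.ext (by rw [Subgroup.coe_mul, Subgroup.coe_mul, Subgroup.coe_inv]; exact hg)⟩

/-- Relabelling twice: `(z ∘ ρ⁻¹) ∘ (ρ' ρ⁻¹)⁻¹ = z ∘ ρ'⁻¹`. [folklore] -/
private theorem comp_symm_mul_inv_symm (z : Fin N → Circle) (ρ ρ' : Perm (Fin N)) :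
    (fun i => (fun j => z (ρ.symm j)) ((ρ' * ρ⁻¹).symm i)) = fun i => z (ρ'.symm i) := by
  funext i
  simp only [Perm.mul_def, Equiv.symm_trans_apply, Perm.inv_def, Equiv.symm_symm, Equiv.symm_apply_apply]

/-- A range with two values: if `F a ≠ F b` and every value is `F a` or `F b` then the range has exactly two elements. [folklore] -/
private theorem ncard_range_eq_two_of_cover {α β : Type*} (F : α → β) (a b : α) (hne : F a ≠ F b)
    (hcover : ∀ x, F x = F a ∨ F x = F b) : {y : β | ∃ x, y = F x}.ncard = 2 := by
  have hrange : {y : β | ∃ x, y = F x} = {F a, F b} := by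
    ext y
    simp only [Set.mem_setOf_eq, Set.mem_insert_iff, Set.mem_singleton_iff]
    constructor
    · rintro ⟨x, rfl⟩; exact hcover x
    · rintro (h | h)
      · exact ⟨a, h⟩
      · exact ⟨b, h⟩
  rw [hrange, Set.ncard_pair hne]

end Bookkeeping

/-! ## §1 `N = 3`: the split-singular torus point -/

section SplitSingular

variable {e : Fin 3 → ℝ} {z : Fin 3 → Circle} {k : Fin 3}

open scoped Classical in
/-- **«`b` OVER A NEGATIVE SLOT» AND «`b` OVER A POSITIVE SLOT» ARE NOT CONJUGATE.**  For the split-singular torus point (`z j = z k ↔ j = k`) and form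
entries `e ip > 0`, `e im < 0`, no element of `U(diag e)(ℂ)` conjugates the relabelled point with the singular eigenvalue `b = z k` in slot `im` to the
one with `b` in slot `ip`: by FILE 1 (A) the singleton `b`-fibre would carry `1 = 0` positive entries. [cite: Rogawski1990, §8.3 p. 122 (§8.2 Prop. 8.2.1 p. 118)]
[cite: HornJohnson2013, §4.5 Thm 4.5.8 (Sylvester)] -/
theorem not_exists_conj_circleDiagonal_swap_neg_swap_pos (hk : ∀ j, z j = z k ↔ j = k) {ip im : Fin 3} (hip : 0 < e ip) (him : e im < 0) :
    ¬ ∃ g : unitaryGroupOfForm (starRingEnd ℂ) (Matrix.diagonal fun j => (e j : ℂ)),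
      (g : GL (Fin 3) ℂ) * circleDiagonal 3 (fun i => z ((Equiv.swap k im).symm i)) * (g : GL (Fin 3) ℂ)⁻¹ =
        circleDiagonal 3 (fun i => z ((Equiv.swap k ip).symm i)) := by
  rintro ⟨g, hg⟩
  rw [← comp_symm_mul_inv_symm z (Equiv.swap k im) (Equiv.swap k ip)] at hg
  have hA := card_filter_fibre_pos_eq_of_conj_circleDiagonal 3 g hg (z k)
  rw [card_filter_fibre_singular hk (Equiv.swap k im) (fun j => 0 < e ((Equiv.swap k ip * (Equiv.swap k im)⁻¹) j)),
    card_filter_fibre_singular hk (Equiv.swap k im) (fun j => 0 < e j)] at hA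
  have h1 : (Equiv.swap k ip * (Equiv.swap k im)⁻¹) (Equiv.swap k im k) = ip := by
    rw [Perm.mul_apply, Perm.inv_def, Equiv.symm_apply_apply, Equiv.swap_apply_left]
  rw [h1, Equiv.swap_apply_left, if_pos hip, if_neg (not_lt.mpr him.le)] at hA
  exact one_ne_zero hA

open scoped Classical in
/-- **RELABELLED POINTS WITH `b`-SLOTS OF THE SAME SIGN ARE CONJUGATE** (`e_j ≠ 0`, `z` two-valued with singular slot `k`): if the form entries at
the `b`-slots `ρ k`, `ρ' k` of two relabelled points have the same sign, the points are conjugate in `U(diag e)(ℂ)` (FILE 1 (B): the `b`-fibres are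
singletons with matching signs, the `a`-fibre counts then agree by complementation, all other fibres are empty). [cite: Rogawski1990, §8.3 p. 122 (§8.2 Prop. 8.2.1 p. 118); §3.8 pp. 30–32 (Prop. 3.8.1)] -/
theorem exists_conj_circleDiagonal_perm_of_pos_iff (he : ∀ j, e j ≠ 0) (hk : ∀ j, z j = z k ↔ j = k)
    (hzz : ∀ i j, i ≠ k → j ≠ k → z i = z j) (ρ ρ' : Perm (Fin 3)) (hs : 0 < e (ρ k) ↔ 0 < e (ρ' k)) :
    ∃ g : unitaryGroupOfForm (starRingEnd ℂ) (Matrix.diagonal fun j => (e j : ℂ)),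
      (g : GL (Fin 3) ℂ) * circleDiagonal 3 (fun i => z (ρ.symm i)) * (g : GL (Fin 3) ℂ)⁻¹ = circleDiagonal 3 (fun i => z (ρ'.symm i)) := by
  rw [← comp_symm_mul_inv_symm z ρ ρ']
  refine exists_conj_circleDiagonal_eq_of_card_filter_fibre_pos_eq 3 he ?_
  -- an `a`-slot
  obtain ⟨i₀, hi₀⟩ := exists_ne k
  have htwo : ∀ j, z j = z k ∨ z j = z i₀ := fun j => by
    by_cases hj : j = k
    · exact Or.inl (by rw [hj])
    · exact Or.inr (hzz j i₀ hj hi₀)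
  -- every fibre except possibly the `a`-fibre
  have hother : ∀ c, c ≠ z i₀ →
      (univ.filter fun j => z (ρ.symm j) = c ∧ 0 < e ((ρ' * ρ⁻¹) j)).card = (univ.filter fun j => z (ρ.symm j) = c ∧ 0 < e j).card := by
    intro c hc
    by_cases hcb : c = z k
    · rw [hcb, card_filter_fibre_singular hk ρ (fun j => 0 < e ((ρ' * ρ⁻¹) j)), card_filter_fibre_singular hk ρ (fun j => 0 < e j),
        Perm.mul_apply, Perm.inv_def, Equiv.symm_apply_apply]
      exact if_congr hs.symm rfl rfl
    · have hcne : ∀ j, z j ≠ c := fun j hj => by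
        rcases htwo j with h | h
        · exact hcb (hj.symm.trans h)
        · exact hc (hj.symm.trans h)
      rw [card_filter_fibre_eq_zero_of_forall_ne hcne, card_filter_fibre_eq_zero_of_forall_ne hcne]
  intro c
  by_cases hc : c = z i₀
  · rw [hc]
    exact card_filter_fibre_eq_of_forall_ne (fun j => z (ρ.symm j)) (fun j => 0 < e ((ρ' * ρ⁻¹) j)) (fun j => 0 < e j)
      (card_filter_pos_perm e (ρ' * ρ⁻¹)) (z i₀) hother
  · exact hother c hc

open scoped Classical in
/-- **EXACTLY TWO CLASSES THROUGH THE SPLIT-SINGULAR POINT.**  For `e : Fin 3 → ℝ` indefinite with no zero entry (`U(diag e)(ℂ) ≅ U(2,1)`) and a torus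
point `diag z` with exactly two eigenvalues (`z = (a,a,b)` in some order: singular slot `k`), the six relabelled torus points `diag (z ∘ ρ⁻¹)`,
`ρ ∈ S₃`, of the stable class of `γ₀ = diag(a,a,b)` fall into EXACTLY TWO conjugacy classes of `U(diag e)(ℂ)` — «`b` over a positive slot» and
«`b` over a negative slot» — against `3 = choose 3 1` classes through a regular torus point («(V8)-reg»).  At a complex place `w` of a CM field with
`σ_w α` real this is the statement for `G_w = archLocal L 3 (diagonal α) w`, `e = re ∘ σ_w ∘ α`. [cite: Rogawski1990, §8.3 p. 122 (§8.2 Prop. 8.2.1 p. 118); §3.8 pp. 30–32 (Prop. 3.8.1)] -/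
theorem ncard_conjClasses_circleDiagonal_perm_eq_two (he : ∀ j, e j ≠ 0) (hind : ∃ i j, 0 < e i ∧ e j < 0)
    (hk : ∀ j, z j = z k ↔ j = k) (hzz : ∀ i j, i ≠ k → j ≠ k → z i = z j) :
    {q : ConjClasses (unitaryGroupOfForm (starRingEnd ℂ) (Matrix.diagonal fun j => (e j : ℂ))) |
        ∃ ρ : Perm (Fin 3), q = ConjClasses.mk ⟨circleDiagonal 3 (fun i => z (ρ.symm i)),
          circleDiagonal_mem_unitaryGroupOfForm_diagonal 3 _ _⟩}.ncard = 2 := by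
  obtain ⟨ip, im, hip, him⟩ := hind
  -- the two candidate representatives, as elements of `U`
  have hbridge : ∀ ρ ρ' : Perm (Fin 3),
      ConjClasses.mk (⟨circleDiagonal 3 (fun i => z (ρ.symm i)), circleDiagonal_mem_unitaryGroupOfForm_diagonal 3 _ _⟩ :
          unitaryGroupOfForm (starRingEnd ℂ) (Matrix.diagonal fun j => (e j : ℂ))) =
        ConjClasses.mk ⟨circleDiagonal 3 (fun i => z (ρ'.symm i)), circleDiagonal_mem_unitaryGroupOfForm_diagonal 3 _ _⟩ ↔
      ∃ g : unitaryGroupOfForm (starRingEnd ℂ) (Matrix.diagonal fun j => (e j : ℂ)),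
        (g : GL (Fin 3) ℂ) * circleDiagonal 3 (fun i => z (ρ.symm i)) * (g : GL (Fin 3) ℂ)⁻¹ = circleDiagonal 3 (fun i => z (ρ'.symm i)) :=
    fun ρ ρ' => conjClasses_mk_eq_mk_iff_exists_coe_conj' _ _
  refine ncard_range_eq_two_of_cover
    (fun ρ : Perm (Fin 3) => ConjClasses.mk (⟨circleDiagonal 3 (fun i => z (ρ.symm i)), circleDiagonal_mem_unitaryGroupOfForm_diagonal 3 _ _⟩ :
      unitaryGroupOfForm (starRingEnd ℂ) (Matrix.diagonal fun j => (e j : ℂ))))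
    (Equiv.swap k ip) (Equiv.swap k im) ?_ ?_
  · -- the two representatives are not conjugate
    intro h
    exact not_exists_conj_circleDiagonal_swap_neg_swap_pos hk hip him ((hbridge _ _).mp h.symm)
  · -- every relabelled point is conjugate to one of the two
    intro ρ
    rcases lt_or_gt_of_ne (he (ρ k)) with hneg | hpos
    · refine Or.inr ((hbridge _ _).mpr ?_)
      exact exists_conj_circleDiagonal_perm_of_pos_iff he hk hzz ρ (Equiv.swap k im)
        (by rw [Equiv.swap_apply_left]; exact ⟨fun h => (lt_irrefl _ (hneg.trans h)).elim, fun h => (lt_irrefl _ (him.trans h)).elim⟩)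
    · refine Or.inl ((hbridge _ _).mpr ?_)
      exact exists_conj_circleDiagonal_perm_of_pos_iff he hk hzz ρ (Equiv.swap k ip)
        (by rw [Equiv.swap_apply_left]; exact ⟨fun _ => hip, fun _ => hpos⟩)

end SplitSingular

end Literature.NumberTheory.Automorphic.UnitaryGroup
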